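import Summits.Ventures.KdS.RouteWGaugeGlue
import Literature.Analysis.ODE.HeunMobius
import Literature.Geometry.Lorentzian.KerrDeSitterHeunEquivalence
import Literature.Geometry.Lorentzian.KerrDeSitterPartialModeStabilityNonzeroFreq
import HarnessLib

/-!
# Venture KdS — ROUTE W: the transfer `K_A` reduced to ONE algebraic identity (`RouteW.Transfer`)

HONEST FRAMING (venture `Summits/Ventures/KdS`, cell `pub-kds`): this file proves
`transfer_of_accessoryIdentity : AccessoryIdentity → RouteW.Transfer`, where `AccessoryIdentity` is a
single explicit polynomial identity between Hatsuda's accessory quantity `v` (tree `heunV`) pushed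
through the Möbius automorphism `x = z_r(z−1)/z` (`GeneralHeun.mobiusQ`) and the Euler-gauge
accessory parameter of Casals–Teixeira da Costa's masses (`eulerGaugeQ … bigE …`). Everything
analytic in `Transfer` is PROVED here from landed theorems: LIT-1's
`heunSolution_of_isRadialTeukolskySolution`, `heunSolution_branch_at_zero`,
`heunSolution_smooth_at_one` (Hatsuda gauge on `z_H ∈ (0,1)`), the Möbius automorphism
`GeneralHeun.isSolutionOn_mobius` (`v(z) = z^{−σ₋} y_H(z_r(z−1)/z)`), and the dictionary
`B_j = −η_j` (`horizonB_rPlus_eq_neg_etaEvent`, `…rCosmo…`, here `…rMinus…`), `z₂ = z_r/(z_r−1)`.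
Nothing about Kerr–de Sitter modes is claimed; H1′/H3 stay cited.
-/

noncomputable section

open Set Complex

namespace Summit.Ventures.KdS

namespace RouteW

open Literature.Analysis.ODE Literature.Analysis.ODE.GeneralHeun
open Literature.Geometry.Lorentzian Literature.Geometry.Lorentzian.KerrDeSitter

/-! ### Dictionary: Hatsuda's data versus the Euler gauge of CTdC's masses -/

/-- **`B(r₋) = −η₀`** (Cauchy horizon), for every subextremal geometry (including `a = 0`, where
both sides are `0`). -/
theorem horizonB_rMinus_eq_neg_etaCauchy {M a Λ : ℝ} (hsub : IsSubextremal M a Λ) (ω : ℂ) (m : ℝ) :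
    horizonB M a Λ ω m (rMinus M a Λ) = -etaCauchy M a Λ ω m := by
  have hd := deltaDeriv_rMinus_eq hsub
  have hκ := surfaceGravity_rMinus_eq hsub
  have h0 := rMinus_nonneg M a Λ
  obtain ⟨hM, hΛ, h01, h12, -⟩ := hsub
  have hξ := xi_pos hΛ.le a
  have hP : 0 < Λ / 3 * (rPlus M a Λ - rMinus M a Λ) * (rCosmo M a Λ - rMinus M a Λ) *
      (2 * rMinus M a Λ + rPlus M a Λ + rCosmo M a Λ) := by
    have hΛ3 : 0 < Λ / 3 := by positivity
    exact mul_pos (mul_pos (mul_pos hΛ3 (by linarith)) (by linarith)) (by linarith)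
  unfold horizonB etaCauchy etaOf horizonAngVel radialK
  rw [hκ, hd]
  by_cases hra : rMinus M a Λ ^ 2 + a ^ 2 = 0
  · -- then a = 0 and r₋ = 0: both sides vanish
    have ha : a = 0 := by nlinarith [sq_nonneg (rMinus M a Λ), sq_nonneg a]
    have hr : rMinus M a Λ = 0 := by nlinarith [sq_nonneg (rMinus M a Λ), sq_nonneg a]
    subst ha
    simp [hr]
  · have hra' : ((rMinus M a Λ : ℂ) ^ 2 + (a : ℂ) ^ 2) ≠ 0 := by exact_mod_cast hra
    have hP' : ((Λ / 3 * (rPlus M a Λ - rMinus M a Λ) * (rCosmo M a Λ - rMinus M a Λ) *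
      (2 * rMinus M a Λ + rPlus M a Λ + rCosmo M a Λ) : ℝ) : ℂ) ≠ 0 := by exact_mod_cast hP.ne'
    have hξ' : (xi a Λ : ℂ) ≠ 0 := by exact_mod_cast hξ.ne'
    push_cast at hra' hP' ⊢
    field_simp
    ring

/-- `B(r₋') = η₀ + η₁ + η₂` (negative root), from `Σ_j B_j = 0`. -/
theorem horizonB_rNeg_eq {M a Λ : ℝ} (hsub : IsSubextremal M a Λ) (ω : ℂ) (m : ℝ) :
    horizonB M a Λ ω m (rNeg M a Λ) =
      etaCauchy M a Λ ω m + etaEvent M a Λ ω m + etaCosmo M a Λ ω m := by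
  have h := horizonB_sum hsub ω m
  rw [horizonB_rPlus_eq_neg_etaEvent hsub, horizonB_rCosmo_eq_neg_etaCosmo hsub,
    horizonB_rMinus_eq_neg_etaCauchy hsub] at h
  linear_combination h

/-- `σ₋ = 1 + s + 2η₀ = eulerGaugeα m₂ m₃`. -/
theorem heunSigmaMinus_eq {M a Λ : ℝ} (hsub : IsSubextremal M a Λ) (s : ℝ) (ω : ℂ) (m : ℝ) :
    heunSigmaMinus M a Λ s ω m = eulerGaugeα (mass₂ M a Λ ω m) (mass₃ M a Λ s ω m) := by
  unfold heunSigmaMinus mass₂ mass₃ eulerGaugeα sqcdM₂ sqcdM₃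
  rw [horizonB_rMinus_eq_neg_etaCauchy hsub]
  ring

/-- `γ_H = 1 + s − 2η₁ = eulerGaugeδ m₁ m₂`. -/
theorem heunGamma_eq {M a Λ : ℝ} (hsub : IsSubextremal M a Λ) (s : ℝ) (ω : ℂ) (m : ℝ) :
    heunGamma M a Λ s ω m = eulerGaugeδ (mass₁ M a Λ s ω m) (mass₂ M a Λ ω m) := by
  unfold heunGamma mass₁ mass₂ eulerGaugeδ sqcdM₁ sqcdM₂
  rw [horizonB_rPlus_eq_neg_etaEvent hsub]
  ring

/-- `δ_H = 1 + s − 2η₂ = eulerGaugeε m₃ m₄`. -/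
theorem heunDelta_eq {M a Λ : ℝ} (hsub : IsSubextremal M a Λ) (s : ℝ) (ω : ℂ) (m : ℝ) :
    heunDelta M a Λ s ω m = eulerGaugeε (mass₃ M a Λ s ω m) (mass₄ M a Λ ω m) := by
  unfold heunDelta mass₃ mass₄ eulerGaugeε sqcdM₃ sqcdM₄
  rw [horizonB_rCosmo_eq_neg_etaCosmo hsub]
  ring

/-- `1 + σ₋ − σ₊ = 1 − s + 2η₀ = eulerGaugeγ m₁ m₂`. -/
theorem mobiusγ_eq {M a Λ : ℝ} (hsub : IsSubextremal M a Λ) (s : ℝ) (ω : ℂ) (m : ℝ) :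
    mobiusγ (heunSigmaPlus s) (heunSigmaMinus M a Λ s ω m) =
      eulerGaugeγ (mass₁ M a Λ s ω m) (mass₂ M a Λ ω m) := by
  unfold mobiusγ heunSigmaPlus heunSigmaMinus mass₁ mass₂ eulerGaugeγ sqcdM₁ sqcdM₂
  rw [horizonB_rMinus_eq_neg_etaCauchy hsub]
  ring

/-- `σ₋ + 1 − ε_H = 1 − 2η₁ − 2η₂ = eulerGaugeβ m₂ m₄`. -/
theorem mobiusβ_eq {M a Λ : ℝ} (hsub : IsSubextremal M a Λ) (s : ℝ) (ω : ℂ) (m : ℝ) :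
    mobiusβ (heunSigmaMinus M a Λ s ω m) (heunEps M a Λ s ω m) =
      eulerGaugeβ (mass₂ M a Λ ω m) (mass₄ M a Λ ω m) := by
  unfold mobiusβ heunSigmaMinus heunEps mass₂ mass₄ eulerGaugeβ sqcdM₂ sqcdM₄
  rw [horizonB_rMinus_eq_neg_etaCauchy hsub, horizonB_rNeg_eq hsub]
  ring

/-- The branch exponent at the event horizon: `1 − γ_H = 2η₁ − s`. -/
theorem one_sub_heunGamma {M a Λ : ℝ} (hsub : IsSubextremal M a Λ) (s : ℝ) (ω : ℂ) (m : ℝ) :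
    1 - heunGamma M a Λ s ω m = 2 * etaEvent M a Λ ω m - (s : ℂ) := by
  unfold heunGamma
  rw [horizonB_rPlus_eq_neg_etaEvent hsub]
  ring

/-- `z₂ = z_r/(z_r − 1)`: CTdC's `z₂` is the Möbius image parameter of Hatsuda's `z_r`. -/
theorem mobiusA_mobiusZr {M a Λ : ℝ} (hsub : IsSubextremal M a Λ) :
    mobiusA (mobiusZr M a Λ) = zTwo M a Λ := by
  have h0 := rMinus_nonneg M a Λ
  obtain ⟨hM, hΛ, h01, h12, -⟩ := hsub
  unfold mobiusA mobiusZr mobiusZ zTwo ctdcZ₂ ctdcZinf rNeg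
  have h1 : rCosmo M a Λ - rPlus M a Λ ≠ 0 := by linarith
  have h2 : -(rMinus M a Λ + rPlus M a Λ + rCosmo M a Λ) - rMinus M a Λ ≠ 0 := by linarith
  have h3 : rPlus M a Λ - rMinus M a Λ ≠ 0 := by linarith
  have h4 : rCosmo M a Λ + (rMinus M a Λ + rPlus M a Λ + rCosmo M a Λ) ≠ 0 := by linarith
  have h5 : (rCosmo M a Λ - rMinus M a Λ) * (-(rMinus M a Λ + rPlus M a Λ + rCosmo M a Λ) - rPlus M a Λ) -
      (rCosmo M a Λ - rPlus M a Λ) * (-(rMinus M a Λ + rPlus M a Λ + rCosmo M a Λ) - rMinus M a Λ) ≠ 0 := by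
    nlinarith
  field_simp
  ring

/-- `1 < z₂`. -/
theorem one_lt_zTwo {M a Λ : ℝ} (hsub : IsSubextremal M a Λ) : 1 < zTwo M a Λ := by
  rw [← mobiusA_mobiusZr hsub]
  have hz := one_lt_mobiusZr hsub
  unfold mobiusA
  rw [lt_div_iff₀ (by linarith)]
  linarith

end RouteW

end Summit.Ventures.KdS

namespace Summit.Ventures.KdS

namespace RouteW

open Literature.Analysis.ODE Literature.Analysis.ODE.GeneralHeun
open Literature.Geometry.Lorentzian Literature.Geometry.Lorentzian.KerrDeSitter

/-! ### The `λ̄`-block simplifies: the `Ξ²` terms cancel -/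

/-- `LT = (3/Λ)(λ − s(1−α))/((r_c − r₋')(r₊ − r₋))`: inside CTdC's `λ̄ − 2Ξ²amω + a²Ξ²ω²` the
`Ξ²`-terms of `lambdaBar` cancel, leaving the STU constant `λ − s(1−α)` (useful for the residual
identity below: the `λ̄`-block carries no `ω`). -/
theorem ltBlock_eq (M a Λ s : ℝ) (ω : ℂ) (m : ℝ) (lam : ℂ) :
    ltBlock M a Λ s ω m lam =
      ((3 / Λ : ℝ) : ℂ) * (lam - ((s * (1 - alpha a Λ) : ℝ) : ℂ)) /
        ((((rCosmo M a Λ - rNeg M a Λ) * (rPlus M a Λ - rMinus M a Λ)) : ℝ) : ℂ) := by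
  unfold ltBlock lambdaBar
  ring

/-! ### The residual algebraic identity and the transfer -/

/-- **The one identity left in `K_A`**: Hatsuda's accessory quantity `v` (tree `heunV`, (2.21))
pushed through the Möbius automorphism `x = z_r(z−1)/z`, `y ↦ z^{−σ₋}y` (`GeneralHeun.mobiusQ`)
equals the Euler-gauge accessory parameter of Casals–Teixeira da Costa's masses with their `E` of
(3.15b) (`eulerGaugeQ … bigE …`). A polynomial identity in the horizon data (exact CAS check: pub-kds
kit j167464 / j167997); its Lean proof is bookkeeping with `vieta_sq`, `vieta_M`, the `B_j = −η_j`
lemmas and `field_simp; ring`. -/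
def AccessoryIdentity : Prop :=
  ∀ (M a Λ s : ℝ) (ω : ℂ) (m : ℝ) (lam : ℂ), IsSubextremal M a Λ →
    mobiusQ (mobiusZr M a Λ) (heunSigmaPlus s) (heunSigmaMinus M a Λ s ω m) (heunGamma M a Λ s ω m)
        (heunDelta M a Λ s ω m) (heunV M a Λ s ω m lam) =
      eulerGaugeQ (mass₁ M a Λ s ω m) (mass₂ M a Λ ω m) (mass₃ M a Λ s ω m) (mass₄ M a Λ ω m)
        (bigE M a Λ s ω m lam) (zTwo M a Λ : ℂ)

/-- `mobiusX z_r w − 1 = (z_r − 1)(w − z₂)/w` with `z₂ = z_r/(z_r − 1)`. -/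
theorem mobiusX_sub_one {zr z₂ w : ℝ} (hA : zr / (zr - 1) = z₂) (hzr : 1 < zr) (hw : w ≠ 0) :
    mobiusX zr w - 1 = (zr - 1) * (w - z₂) / w := by
  unfold mobiusX
  rw [← hA]
  have : zr - 1 ≠ 0 := by linarith
  field_simp
  ring

/-- The Möbius map `z ↦ z_r(z−1)/z` is `C^∞` away from `0`. -/
theorem contDiffOn_mobiusX (zr : ℝ) {S : Set ℝ} (hS : ∀ w ∈ S, w ≠ 0) :
    ContDiffOn ℝ ((⊤ : ℕ∞) : WithTop ℕ∞) (mobiusX zr) S := by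
  unfold mobiusX
  exact (contDiffOn_const.mul (contDiffOn_id.sub contDiffOn_const)).div contDiffOn_id hS

/-- **`K_A` from the accessory identity.** -/
theorem transfer_of_accessoryIdentity (hQ : AccessoryIdentity) : Transfer := by
  intro M a Λ s ω m lam R hsub hR hin hout
  refine ⟨one_lt_zTwo hsub, ?_⟩
  have hsol := heunSolution_of_isRadialTeukolskySolution hsub hR
  have hbr := heunSolution_branch_at_zero hsub hin
  have hreg := heunSolution_smooth_at_one hsub s hout
  set y : ℝ → ℂ := fun x => R (mobiusInv M a Λ x) / heunWeight M a Λ s ω m (mobiusInv M a Λ x)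
    with hy
  have hzr1 : 1 < mobiusZr M a Λ := one_lt_mobiusZr hsub
  have hzr0 : 0 < mobiusZr M a Λ := by linarith
  have hz₂ := one_lt_zTwo hsub
  have hA : mobiusA (mobiusZr M a Λ) = zTwo M a Λ := mobiusA_mobiusZr hsub
  have hA' : mobiusZr M a Λ / (mobiusZr M a Λ - 1) = zTwo M a Λ := hA
  -- where the Möbius map sends (1, z₂)
  have hV : ∀ z ∈ Ioo 1 (zTwo M a Λ), 0 < z ∧ mobiusX (mobiusZr M a Λ) z ∈ Ioo (0 : ℝ) 1 := by
    intro z hz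
    obtain ⟨hz1, hzz⟩ := hz
    have hz0 : 0 < z := by linarith
    refine ⟨hz0, ?_, ?_⟩
    · unfold mobiusX
      exact div_pos (mul_pos hzr0 (by linarith)) hz0
    · unfold mobiusX
      rw [div_lt_one hz0]
      rw [← hA'] at hzz
      have h1 : z * (mobiusZr M a Λ - 1) < mobiusZr M a Λ := (lt_div_iff₀ (by linarith)).mp hzz
      have key : mobiusZr M a Λ * (z - 1) = z * (mobiusZr M a Λ - 1) + (z - mobiusZr M a Λ) := by ring
      nlinarith
  -- the transformed solution, with all parameters rewritten into the Euler gauge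
  have hmob := isSolutionOn_mobius (heun_fuchs hsub s ω m) (ne_of_gt hzr1) hV hsol
  rw [hQ M a Λ s ω m lam hsub, mobiusβ_eq hsub, mobiusγ_eq hsub, heunGamma_eq hsub, heunDelta_eq hsub,
    heunSigmaMinus_eq hsub, hA] at hmob
  set αE := eulerGaugeα (mass₂ M a Λ ω m) (mass₃ M a Λ s ω m) with hαE
  refine ⟨mobiusV (mobiusZr M a Λ) αE y, ⟨hmob, ?_, ?_⟩, ?_⟩
  · -- branch at z = 1 with exponent ρ = 2η₁ − s
    obtain ⟨ε, hε, G, hG, hGy⟩ := hbr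
    rw [one_sub_heunGamma hsub] at hGy
    set ρ := 2 * etaEvent M a Λ ω m - (s : ℂ) with hρ
    set e := min (1 / 2 : ℝ) (ε / (4 * mobiusZr M a Λ)) with hedef
    have he : 0 < e := lt_min (by norm_num) (by positivity)
    have he1 : e ≤ 1 / 2 := min_le_left _ _
    have he2 : e * (4 * mobiusZr M a Λ) ≤ ε := by
      have : e ≤ ε / (4 * mobiusZr M a Λ) := min_le_right _ _
      exact (le_div_iff₀ (by positivity)).mp this
    -- the two-sided interval around 1 is mapped into (−ε, ε) and consists of positive numbers
    have hpos : ∀ w ∈ Ioo (1 - e) (1 + e), 0 < w := by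
      intro w hw; obtain ⟨hwl, -⟩ := hw; linarith
    have hmaps : ∀ w ∈ Ioo (1 - e) (1 + e), mobiusX (mobiusZr M a Λ) w ∈ Ioo (-ε) ε := by
      intro w hw
      obtain ⟨hwl, hwr⟩ := hw
      have hw0 : 0 < w := by linarith
      unfold mobiusX
      constructor
      · rw [lt_div_iff₀ hw0]
        nlinarith
      · rw [div_lt_iff₀ hw0]
        nlinarith
    refine ⟨e, he, fun w => eulerKernel αE w * eulerKernel (-ρ) (mobiusZr M a Λ / w) *
        G (mobiusX (mobiusZr M a Λ) w), ?_, ?_⟩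
    · refine ((contDiffOn_eulerKernel_of_pos αE hpos).mul ?_).mul ?_
      · exact (contDiffOn_eulerKernel (-ρ)).comp (contDiffOn_const.div contDiffOn_id
          (fun w hw => (hpos w hw).ne')) (fun w hw => div_pos hzr0 (hpos w hw))
      · exact hG.comp (contDiffOn_mobiusX _ (fun w hw => (hpos w hw).ne')) hmaps
    · intro w hw
      obtain ⟨hw1, hwr⟩ := hw
      have hw0 : 0 < w := by linarith
      have hx : mobiusX (mobiusZr M a Λ) w ∈ Ioo (0 : ℝ) ε := by
        refine ⟨?_, (hmaps w ⟨by linarith, hwr⟩).2⟩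
        unfold mobiusX
        exact div_pos (mul_pos hzr0 (by linarith)) hw0
      have hyx := hGy _ hx
      have hxe : mobiusX (mobiusZr M a Λ) w = (w - 1) * (mobiusZr M a Λ / w) := by
        unfold mobiusX; field_simp
      have hq : 0 < mobiusZr M a Λ / w := div_pos hzr0 hw0
      simp only [mobiusV]
      rw [hyx, hxe, Complex.ofReal_mul, Complex.mul_cpow_ofReal_nonneg (by linarith) hq.le,
        ← eulerKernel_neg_eq_cpow ρ hq]
      push_cast
      ring
  · -- the analytic branch at z₂
    obtain ⟨ε, hε, F, hF, hFy⟩ := hreg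
    set z₂ := zTwo M a Λ with hz₂def
    set e := min (z₂ / 2) (ε * z₂ / (4 * (mobiusZr M a Λ - 1))) with hedef
    have hzrm : 0 < mobiusZr M a Λ - 1 := by linarith
    have he : 0 < e := lt_min (by linarith) (by positivity)
    have he1 : e ≤ z₂ / 2 := min_le_left _ _
    have he2 : e * (4 * (mobiusZr M a Λ - 1)) ≤ ε * z₂ := by
      have : e ≤ ε * z₂ / (4 * (mobiusZr M a Λ - 1)) := min_le_right _ _
      exact (le_div_iff₀ (by positivity)).mp this
    have hpos : ∀ w ∈ Ioo (z₂ - e) (z₂ + e), 0 < w := by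
      intro w hw; obtain ⟨hwl, -⟩ := hw; linarith
    have hmaps : ∀ w ∈ Ioo (z₂ - e) (z₂ + e), mobiusX (mobiusZr M a Λ) w ∈ Ioo (1 - ε) (1 + ε) := by
      intro w hw
      have hw0 := hpos w hw
      obtain ⟨hwl, hwr⟩ := hw
      have hsub1 := mobiusX_sub_one hA' hzr1 hw0.ne'
      have hw2 : z₂ / 2 < w := by linarith
      constructor
      · have : -(ε) < (mobiusZr M a Λ - 1) * (w - z₂) / w := by
          rw [lt_div_iff₀ hw0]; nlinarith
        linarith
      · have : (mobiusZr M a Λ - 1) * (w - z₂) / w < ε := by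
          rw [div_lt_iff₀ hw0]; nlinarith
        linarith
    refine ⟨e, he, fun w => eulerKernel αE w * F (mobiusX (mobiusZr M a Λ) w), ?_, ?_⟩
    · exact (contDiffOn_eulerKernel_of_pos αE hpos).mul
        (hF.comp (contDiffOn_mobiusX _ (fun w hw => (hpos w hw).ne')) hmaps)
    · intro w hw
      obtain ⟨hwl, hwr⟩ := hw
      have hw0 : 0 < w := hpos w ⟨hwl, by linarith⟩
      have hx1 : mobiusX (mobiusZr M a Λ) w < 1 := by
        have hsub1 := mobiusX_sub_one hA' hzr1 hw0.ne'
        have : (mobiusZr M a Λ - 1) * (w - z₂) / w < 0 :=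
          div_neg_of_neg_of_pos (mul_neg_of_pos_of_neg hzrm (by linarith)) hw0
        linarith
      have hx : mobiusX (mobiusZr M a Λ) w ∈ Ioo (1 - ε) 1 :=
        ⟨(hmaps w ⟨hwl, by linarith⟩).1, hx1⟩
      simp only [mobiusV]
      rw [hFy _ hx]
  · -- injectivity: v ≡ 0 on (1, z₂) ⇒ y ≡ 0 on (0, 1) ⇒ R ≡ 0 on (r₊, r_c)
    intro hv r hr
    have hx := mobiusZ_mem_Ioo hsub hr
    set x := mobiusZ M a Λ r with hxdef
    obtain ⟨hx0, hx1⟩ := hx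
    have hzx : 0 < mobiusZr M a Λ - x := by linarith
    -- the point w = z_r/(z_r − x) ∈ (1, z₂) with mobiusX z_r w = x
    have hw1 : 1 < mobiusZr M a Λ / (mobiusZr M a Λ - x) := by
      rw [lt_div_iff₀ hzx]; linarith
    have hw2 : mobiusZr M a Λ / (mobiusZr M a Λ - x) < zTwo M a Λ := by
      rw [← hA', div_lt_div_iff_of_pos_left hzr0 hzx (by linarith)]
      linarith
    have hX : mobiusX (mobiusZr M a Λ) (mobiusZr M a Λ / (mobiusZr M a Λ - x)) = x := by
      unfold mobiusX
      field_simp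
      ring
    have h0 := hv _ ⟨hw1, hw2⟩
    simp only [mobiusV] at h0
    rw [hX] at h0
    rcases mul_eq_zero.mp h0 with hk | hyx
    · exact absurd hk (eulerKernel_ne_zero _ _)
    · -- y x = R r / w r
      have hrm : r ≠ rMinus M a Λ := by
        obtain ⟨-, -, h01, -⟩ := hsub
        intro h; rw [h] at hr; exact absurd hr.1 (by linarith)
      have hinv := mobiusInv_mobiusZ hsub hrm
      simp only [hy, hxdef] at hyx
      rw [hinv] at hyx
      rcases div_eq_zero_iff.mp hyx with hR0 | hw0
      · exact hR0
      · exact absurd hw0 (heunWeight_ne_zero hsub s ω m hr)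

end RouteW

end Summit.Ventures.KdS
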